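import Summits.QuantumFields.BalabanUV.Beta.GAN24.W3SourceRows
import Summits.QuantumFields.BalabanUV.Beta.GAN24.TransportStepLipschitz

/-!
# `BalabanUV.Beta.GAN24.W3ForcingRate` — ROW W3-F4b (`LocStencil₂` half) AS A FUNCTION OF THE TOWER's UNIFORM SHAPE: the FORCING of the
# difference recursion of an2's normalised bi-stencil family, `f_m = (𝒜_{m+1} − 𝒜_m)[x_m] + (b_{m+1} − b_m)` (leaf-01's
# `AffineUnroll.diff_succ` ∕ `diff_eq_transport_add_sum`, the `f` of the owner's END #2 `WSlotT2OfPieces.rate_of_rows`), is `LocStencil₂` with a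
# GEOMETRIC constant `cf·θf^m` at ONE rate — from the K-slot, «E3Shape» ∧ «E3Drift», the mixed-table shape and a UNIFORM `LocStencil₂` bound on
# the members `x_m` read by the transport (for an2's tower: «T2Shape», END #1's output) (G-an2-4 formalisation swarm, leaf prover 08, gen 16)

NOT IN PRINT; OUR PROOF ATTEMPT (composition of tree theorems).  HONEST FRAMING (cell contract, verbatim): «discharging `BetaPertH` makes
Bałaban's UV stability UNCONDITIONAL — a real constructive-QFT result; it is NOT the continuum limit and NOT the Clay problem.»  HONEST
DEPENDENCY (verbatim): «continuum YM on T⁴ ⇐ BetaPertH ∧ nine spine estimates (0/9 proved); BetaPertH ⇐ (D1) ∧ (D4) ∧ CAP+tail; G-an2-4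
gates asym, D1 and NE2/3/4.»

WHAT.  SKELETON-W3 v1.0 §8.3, ROW W3-F4b `hf : ∀ m, LocStencil₂ (f m) (Cf·θ^m) δin ∧ mom (f m) ≤ Cf·θ^m` for the concrete forcing
`f m := (A (m+1) (x m) − A m (x m)) + (b (m+1) − b m)` with `A j := lin4 (cE₂·Lc^{2(d+1)}) K♮_j Lc` (leaf-04), `b :=` the source of record,
`x m := T♮_m`.  THIS module proves the `LocStencil₂` conjunct for ANY family `x` of bi-tables with a uniform `LocStencil₂` bound (`hx`): summand 1
by this lineage's `TransportStepLipschitz.lin_cauchy` (the transport step is Lipschitz in the kernel at the fixed table `x m`; `CauchyDecayK`),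
summand 2 by `W3SourceRows.source_cauchy_of_shapes`; one common ratio `θf = max θK θb`, one common rate, `locStencil₂_add'`.  `lin4`∕`vsym` are
written UNFOLDED over tree names (`T2RecursionAffine` p210349 still at the gate) — by their `rfl`-definitions the conclusion IS
`LocStencil₂ (lin4 c K♮_{m+1} Lc (x m) − lin4 c K♮_m Lc (x m) + (b (m+1) − b m)) (cf·θf^m) δf`.
* **`forcing_locStencil₂_of_shapes`** (generic d); **`forcing_locStencil₂_three`** (d = 3, Lc ≥ 2: residual hypotheses = mixFF shape + `hx`).
NOT HERE: the `mom` conjunct (RULINGS-14 (R14-3)); `hx` itself («T2Shape» = END #1 ∕ ROWS F1a∕F3a∕F4a∕F2a∕F4c); rows F1b, F3b, F2b, F4d.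

HONEST: [folklore] composition; CONDITIONAL on `hx`; instantiates NO wall binder by itself; «T2Shape»∕«T2SupRate» OPEN, NOT IN PRINT; (hW, hWall)
NOT discharged; NOT «W-slot closed», NEVER «G-an2-4 closed», NOT (CONV-C); NOT BetaPertH, NOT continuum, NOT Clay.  0 sorry, 0 cite, 0 def.
-/

noncomputable section

open Literature.MathematicalPhysics.QuantumFieldTheory
open Literature.MathematicalPhysics.QuantumFieldTheory.Balaban1983to89
open Literature.MathematicalPhysics.QuantumFieldTheory.Balaban1983to89.Beta
open B12Sec2to5 (l1 l1_nonneg)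
open ExpKernelCalculus (MKer Decays BiLoc VertexFamily VertexFamily₂ comp)
open OneStepResolventKernel (Fib LocStencil decays_mono)
open OneStepKernelFamily (KInvStep)
open StepJetData (mfNeg)
open BalabanStepJetsSucc (mmRead wE e3Of)
open BalabanCompositeJets (LocStencil₂)
open SecondOrderResponse (W2SymOfK vertex2OfK LocStencilFM cBi)
open BalabanStepW2 (Spure M1 M2Of K3OfK locStencil₂_add')
open AveragingMixedJetTables (vh₂S)
open Summit.QuantumFields.BalabanUV.Beta.HessKerDressedUnits (unitK unitS)
open Summit.QuantumFields.BalabanUV.Beta.SecondOrderUnits (unitM unitM₂)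
open Summit.QuantumFields.BalabanUV.Beta.GAN24.CombesThomas (sfStep smStep UnitDecayK CauchyDecayK)
open Summit.QuantumFields.BalabanUV.Beta.GAN24.StencilSlotOfE3 (one_le_of_two_le)
open Summit.QuantumFields.BalabanUV.Beta.GAN24.SpureUnitDrift (e3ShapeDrift_three)
open Summit.QuantumFields.BalabanUV.Beta.GAN24.WSlotCauchyOfShapes (locStencil₂_le_mono mul_pow_le_mul_pow)
open Summit.QuantumFields.BalabanUV.Beta.GAN24.KSlotAssembly (convCKWall_holds)
open Summit.QuantumFields.BalabanUV.Beta.GAN24.SecondOrderLipschitz (lSand lSand_nonneg)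
open Summit.QuantumFields.BalabanUV.Beta.GAN24.SecondOrderLipschitzBi (lBi lBi_nonneg)
open Summit.QuantumFields.BalabanUV.Beta.GAN24.W3SourceRows (source_cauchy_of_shapes)
open Summit.QuantumFields.BalabanUV.Beta.GAN24.TransportStepLipschitz (lin_cauchy)

namespace Summit.QuantumFields.BalabanUV.Beta.GAN24.W3ForcingRate

variable {d : ℕ} {Lc : ℕ} [NeZero Lc]

/-- **ROW W3-F4b (`LocStencil₂` HALF) AS A FUNCTION OF THE K-SLOT, THE S-SLOT SHAPES, THE MIXED-TABLE SHAPE AND A UNIFORM BOUND ON THE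
TRANSPORTED MEMBERS** [folklore composition; generic d].  For every family `x : ℕ → (bi-tables)` with `∀ j, LocStencil₂ (x j) C₂ δ₂` (`hx`; for
an2's normalised tower this is «T2Shape», END #1's output) the forcing `(𝒜_{m+1} − 𝒜_m)[x m] + (b_{m+1} − b_m)` of leaf-01's
`AffineUnroll.diff_succ` — `𝒜_j = lin4 (cE₂·Lc^{2(d+1)}) K♮_j Lc` unfolded, `b` = the source of record — is `LocStencil₂` with constant `cf·θf^m`,
`0 ≤ θf < 1`, at one rate `δf > 0`: summand 1 by `TransportStepLipschitz.lin_cauchy` (k := m, j := 1; `CauchyDecayK`), summand 2 by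
`W3SourceRows.source_cauchy_of_shapes` (k := m, j := 1), merged at `θf := max θK θb`, `δf := min (m₀/128) δb`, `m₀ := min δ δ₂`. -/
theorem forcing_locStencil₂_of_shapes (hLc : 1 ≤ Lc) {C δ cK θK : ℝ} (hK : UnitDecayK d Lc (sfStep Lc) (smStep d Lc) C δ)
    (hKall : CauchyDecayK d Lc (sfStep Lc) (smStep d Lc) cK θK δ) (hδ : 0 < δ) (hθK0 : 0 ≤ θK) (hθK1 : θK < 1)
    {cE cVH cΛ C₃ c₃ θ₃ δ₃ : ℝ}
    (hE3 : ∀ j : ℕ, LocStencil (unitS (sfStep Lc (j + 1)) (smStep d Lc (j + 1))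
      (fun κ u => (cE * wE d Lc (j + 1)) • e3Of d Lc cE cVH cΛ (j + 1) κ u)) C₃ δ₃)
    (hE3d : ∀ k j : ℕ, LocStencil (fun κ u =>
        unitS (sfStep Lc (k + j + 1)) (smStep d Lc (k + j + 1))
            (fun κ u => (cE * wE d Lc (k + j + 1)) • e3Of d Lc cE cVH cΛ (k + j + 1) κ u) κ u -
          unitS (sfStep Lc (k + 1)) (smStep d Lc (k + 1))
            (fun κ u => (cE * wE d Lc (k + 1)) • e3Of d Lc cE cVH cΛ (k + 1) κ u) κ u) (c₃ * θ₃ ^ k) δ₃)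
    (hθ₃ : 0 < θ₃) (hθ₃1 : θ₃ < 1) (hδ₃ : 0 < δ₃)
    {mixFF : Fin (d + 1) → (Fin (d + 1) → ℤ) → Fin (d + 1) → (Fin (d + 1) → ℤ) → MKer (d + 1) (Fib d)} {CM₂ δ₄ : ℝ}
    (hmix : LocStencilFM Lc mixFF CM₂ δ₄) (hδ₄ : 0 < δ₄)
    (hfm : ∀ κ u ρ w x z (α μ' : Fin (d + 1)), mixFF κ u ρ w x z (Sum.inl α) (Sum.inr μ') = 0)
    (hm : ∀ κ u ρ w x z (μ' : Fin (d + 1)) (b : Fib d), mixFF κ u ρ w x z (Sum.inr μ') b = 0) (cE₂ cB : ℝ)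
    {x : ℕ → Fin (d + 1) → (Fin (d + 1) → ℤ) → Fin (d + 1) → (Fin (d + 1) → ℤ) → MKer (d + 1) (Fib d)} {C₂ δ₂ : ℝ}
    (hx : ∀ j, LocStencil₂ (x j) C₂ δ₂) (hδ₂ : 0 < δ₂) :
    ∃ cf θf δf : ℝ, 0 ≤ cf ∧ 0 ≤ θf ∧ θf < 1 ∧ 0 < δf ∧ ∀ m, LocStencil₂
      ((fun κ u κ' u' => -((cE₂ * (Lc : ℝ) ^ (2 * (d + 1))) • mmRead Lc (comp (comp (unitK (sfStep Lc (m + 1)) (smStep d Lc (m + 1)) (KInvStep (d := d) Lc (m + 1)))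
          ((1 / 2 : ℝ) • (vertex2OfK (unitK (sfStep Lc (m + 1)) (smStep d Lc (m + 1)) (KInvStep (d := d) Lc (m + 1))) Lc (x m) κ u κ' u'
            + vertex2OfK (unitK (sfStep Lc (m + 1)) (smStep d Lc (m + 1)) (KInvStep (d := d) Lc (m + 1))) Lc (x m) κ' u' κ u))) (unitK (sfStep Lc (m + 1)) (smStep d Lc (m + 1)) (KInvStep (d := d) Lc (m + 1))))))
        - (fun κ u κ' u' => -((cE₂ * (Lc : ℝ) ^ (2 * (d + 1))) • mmRead Lc (comp (comp (unitK (sfStep Lc m) (smStep d Lc m) (KInvStep (d := d) Lc m))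
          ((1 / 2 : ℝ) • (vertex2OfK (unitK (sfStep Lc m) (smStep d Lc m) (KInvStep (d := d) Lc m)) Lc (x m) κ u κ' u'
            + vertex2OfK (unitK (sfStep Lc m) (smStep d Lc m) (KInvStep (d := d) Lc m)) Lc (x m) κ' u' κ u))) (unitK (sfStep Lc m) (smStep d Lc m) (KInvStep (d := d) Lc m)))))
        + ((fun κ u κ' u' => (cE₂ * (Lc : ℝ) ^ (2 * (d + 1))) •
          mmRead Lc (K3OfK (unitK (sfStep Lc (m + 1)) (smStep d Lc (m + 1)) (KInvStep (d := d) Lc (m + 1))) Lc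
            (unitS (sfStep Lc (m + 1)) (smStep d Lc (m + 1)) (Spure d Lc cE cVH cΛ (m + 1))) (unitM (sfStep Lc (m + 1)) (smStep d Lc (m + 1)) (M1 d Lc cΛ (m + 1)))
            (W2SymOfK (unitK (sfStep Lc (m + 1)) (smStep d Lc (m + 1)) (KInvStep (d := d) Lc (m + 1))) Lc
              (unitS (sfStep Lc (m + 1)) (smStep d Lc (m + 1)) (Spure d Lc cE cVH cΛ (m + 1))) (unitM (sfStep Lc (m + 1)) (smStep d Lc (m + 1)) (M1 d Lc cΛ (m + 1))) 0
              (unitM₂ (sfStep Lc (m + 1)) (smStep d Lc (m + 1)) (M2Of d Lc mixFF (m + 1)))) κ u κ' u')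
        + cB • mfNeg (vh₂S d Lc κ u κ' u'))
          - fun κ u κ' u' => (cE₂ * (Lc : ℝ) ^ (2 * (d + 1))) •
          mmRead Lc (K3OfK (unitK (sfStep Lc m) (smStep d Lc m) (KInvStep (d := d) Lc m)) Lc
            (unitS (sfStep Lc m) (smStep d Lc m) (Spure d Lc cE cVH cΛ m)) (unitM (sfStep Lc m) (smStep d Lc m) (M1 d Lc cΛ m))
            (W2SymOfK (unitK (sfStep Lc m) (smStep d Lc m) (KInvStep (d := d) Lc m)) Lc
              (unitS (sfStep Lc m) (smStep d Lc m) (Spure d Lc cE cVH cΛ m)) (unitM (sfStep Lc m) (smStep d Lc m) (M1 d Lc cΛ m)) 0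
              (unitM₂ (sfStep Lc m) (smStep d Lc m) (M2Of d Lc mixFF m))) κ u κ' u')
        + cB • mfNeg (vh₂S d Lc κ u κ' u')))
      (cf * θf ^ m) δf := by
  -- summand 2: the source of record is Cauchy (this lineage's `W3SourceRows`)
  obtain ⟨cb, θb, δb, hcb, hθb0, hθb1, hδb, hsrc⟩ :=
    source_cauchy_of_shapes (d := d) (Lc := Lc) hLc hK hKall hδ hθK0 hθK1 hE3 hE3d hθ₃ hθ₃1 hδ₃ hmix hδ₄ hfm hm cE₂ cB
  -- summand 1: the transport step is Lipschitz in the kernel at the fixed table `x m` (this lineage's `TransportStepLipschitz`)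
  have hC : 0 ≤ C := (hK 0).nonneg (Sum.inl 0)
  have hcK : 0 ≤ cK := by have h := (hKall 0 0).nonneg (Sum.inl 0); simpa using h
  have hC₂ : 0 ≤ C₂ := (hx 0).nonneg
  set m₀ : ℝ := min δ δ₂ with hm₀_def
  have hm₀ : 0 < m₀ := lt_min hδ hδ₂
  have hm₀δ : m₀ ≤ δ := min_le_left _ _
  have hm₀2 : m₀ ≤ δ₂ := min_le_right _ _
  have hK1 : ∀ j, Decays (unitK (sfStep Lc j) (smStep d Lc j) (KInvStep (d := d) Lc j)) C m₀ :=
    fun j => decays_mono (hK j) hC le_rfl hm₀δ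
  have hKc : ∀ k j, Decays (unitK (sfStep Lc (k + j)) (smStep d Lc (k + j)) (KInvStep (d := d) Lc (k + j)) -
      unitK (sfStep Lc k) (smStep d Lc k) (KInvStep (d := d) Lc k)) (cK * θK ^ k) m₀ :=
    fun k j => decays_mono (hKall k j) (by positivity) le_rfl hm₀δ
  have hx₀ : ∀ j, LocStencil₂ (x j) C₂ m₀ := fun j => (hx j).mono hm₀2
  set L₁ : ℝ := |cE₂ * (Lc : ℝ) ^ (2 * (d + 1))| * lSand d C (cBi d C C₂ m₀) cK (lBi d C C₂ cK 0 m₀) (m₀ / 32) with hL₁_def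
  have hL₁ : 0 ≤ L₁ := by
    have h1 : 0 ≤ cBi d C C₂ m₀ := SecondOrderResponse.cBi_nonneg hC hC₂ hm₀
    have h2 : 0 ≤ lBi d C C₂ cK 0 m₀ := lBi_nonneg hC hC₂ hcK le_rfl hm₀
    have h3 : 0 ≤ lSand d C (cBi d C C₂ m₀) cK (lBi d C C₂ cK 0 m₀) (m₀ / 32) := lSand_nonneg hC h1 hcK h2 (by positivity)
    positivity
  -- the common ratio and rate
  set θf : ℝ := max θK θb with hθf_def
  have hθf0 : 0 ≤ θf := hθK0.trans (le_max_left _ _)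
  have hθf1 : θf < 1 := max_lt hθK1 hθb1
  set δf : ℝ := min (m₀ / 128) δb with hδf_def
  have hδf : 0 < δf := lt_min (by positivity) hδb
  refine ⟨L₁ + cb, θf, δf, by positivity, hθf0, hθf1, hδf, fun m => ?_⟩
  have h1 := lin_cauchy (Lc := Lc) hLc hm₀ hK1 hKc (hx₀ m) (cE₂ * (Lc : ℝ) ^ (2 * (d + 1))) m 1
  have h1' := locStencil₂_le_mono h1 (mul_pow_le_mul_pow hL₁ hθK0 (le_max_left θK θb) m) (min_le_left _ _ : δf ≤ m₀ / 128)
  have h2' := locStencil₂_le_mono (hsrc m 1) (mul_pow_le_mul_pow hcb hθb0 (le_max_right θK θb) m) (min_le_right _ _ : δf ≤ δb)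
  have h := locStencil₂_add' h1' h2'
  rw [← add_mul] at h
  exact h

/-- **ROW W3-F4b (`LocStencil₂` HALF) AT `d = 3`, `Lc ≥ 2`, FROM THE MIXED-TABLE SHAPE AND THE UNIFORM BOUND ON THE TRANSPORTED MEMBERS ALONE**
[folklore composition]: K-slot (both rows) by `KSlotAssembly.convCKWall_holds`, «E3Shape» ∧ «E3Drift» by `SpureUnitDrift.e3ShapeDrift_three`, into
`forcing_locStencil₂_of_shapes`. -/
theorem forcing_locStencil₂_three {Lc : ℕ} [NeZero Lc] (hLc : 2 ≤ Lc) (cE cVH cΛ cE₂ cB : ℝ)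
    {mixFF : Fin (3 + 1) → (Fin (3 + 1) → ℤ) → Fin (3 + 1) → (Fin (3 + 1) → ℤ) → MKer (3 + 1) (Fib 3)} {CM₂ δ₄ : ℝ}
    (hmix : LocStencilFM Lc mixFF CM₂ δ₄) (hδ₄ : 0 < δ₄)
    (hfm : ∀ κ u ρ w x z (α μ' : Fin (3 + 1)), mixFF κ u ρ w x z (Sum.inl α) (Sum.inr μ') = 0)
    (hm : ∀ κ u ρ w x z (μ' : Fin (3 + 1)) (b : Fib 3), mixFF κ u ρ w x z (Sum.inr μ') b = 0)
    {x : ℕ → Fin (3 + 1) → (Fin (3 + 1) → ℤ) → Fin (3 + 1) → (Fin (3 + 1) → ℤ) → MKer (3 + 1) (Fib 3)} {C₂ δ₂ : ℝ}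
    (hx : ∀ j, LocStencil₂ (x j) C₂ δ₂) (hδ₂ : 0 < δ₂) :
    ∃ cf θf δf : ℝ, 0 ≤ cf ∧ 0 ≤ θf ∧ θf < 1 ∧ 0 < δf ∧ ∀ m, LocStencil₂
      ((fun κ u κ' u' => -((cE₂ * (Lc : ℝ) ^ (2 * (3 + 1))) • mmRead Lc (comp (comp (unitK (sfStep Lc (m + 1)) (smStep 3 Lc (m + 1)) (KInvStep (d := 3) Lc (m + 1)))
          ((1 / 2 : ℝ) • (vertex2OfK (unitK (sfStep Lc (m + 1)) (smStep 3 Lc (m + 1)) (KInvStep (d := 3) Lc (m + 1))) Lc (x m) κ u κ' u'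
            + vertex2OfK (unitK (sfStep Lc (m + 1)) (smStep 3 Lc (m + 1)) (KInvStep (d := 3) Lc (m + 1))) Lc (x m) κ' u' κ u))) (unitK (sfStep Lc (m + 1)) (smStep 3 Lc (m + 1)) (KInvStep (d := 3) Lc (m + 1))))))
        - (fun κ u κ' u' => -((cE₂ * (Lc : ℝ) ^ (2 * (3 + 1))) • mmRead Lc (comp (comp (unitK (sfStep Lc m) (smStep 3 Lc m) (KInvStep (d := 3) Lc m))
          ((1 / 2 : ℝ) • (vertex2OfK (unitK (sfStep Lc m) (smStep 3 Lc m) (KInvStep (d := 3) Lc m)) Lc (x m) κ u κ' u'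
            + vertex2OfK (unitK (sfStep Lc m) (smStep 3 Lc m) (KInvStep (d := 3) Lc m)) Lc (x m) κ' u' κ u))) (unitK (sfStep Lc m) (smStep 3 Lc m) (KInvStep (d := 3) Lc m)))))
        + ((fun κ u κ' u' => (cE₂ * (Lc : ℝ) ^ (2 * (3 + 1))) •
          mmRead Lc (K3OfK (unitK (sfStep Lc (m + 1)) (smStep 3 Lc (m + 1)) (KInvStep (d := 3) Lc (m + 1))) Lc
            (unitS (sfStep Lc (m + 1)) (smStep 3 Lc (m + 1)) (Spure 3 Lc cE cVH cΛ (m + 1))) (unitM (sfStep Lc (m + 1)) (smStep 3 Lc (m + 1)) (M1 3 Lc cΛ (m + 1)))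
            (W2SymOfK (unitK (sfStep Lc (m + 1)) (smStep 3 Lc (m + 1)) (KInvStep (d := 3) Lc (m + 1))) Lc
              (unitS (sfStep Lc (m + 1)) (smStep 3 Lc (m + 1)) (Spure 3 Lc cE cVH cΛ (m + 1))) (unitM (sfStep Lc (m + 1)) (smStep 3 Lc (m + 1)) (M1 3 Lc cΛ (m + 1))) 0
              (unitM₂ (sfStep Lc (m + 1)) (smStep 3 Lc (m + 1)) (M2Of 3 Lc mixFF (m + 1)))) κ u κ' u')
        + cB • mfNeg (vh₂S 3 Lc κ u κ' u'))
          - fun κ u κ' u' => (cE₂ * (Lc : ℝ) ^ (2 * (3 + 1))) •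
          mmRead Lc (K3OfK (unitK (sfStep Lc m) (smStep 3 Lc m) (KInvStep (d := 3) Lc m)) Lc
            (unitS (sfStep Lc m) (smStep 3 Lc m) (Spure 3 Lc cE cVH cΛ m)) (unitM (sfStep Lc m) (smStep 3 Lc m) (M1 3 Lc cΛ m))
            (W2SymOfK (unitK (sfStep Lc m) (smStep 3 Lc m) (KInvStep (d := 3) Lc m)) Lc
              (unitS (sfStep Lc m) (smStep 3 Lc m) (Spure 3 Lc cE cVH cΛ m)) (unitM (sfStep Lc m) (smStep 3 Lc m) (M1 3 Lc cΛ m)) 0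
              (unitM₂ (sfStep Lc m) (smStep 3 Lc m) (M2Of 3 Lc mixFF m))) κ u κ' u')
        + cB • mfNeg (vh₂S 3 Lc κ u κ' u')))
      (cf * θf ^ m) δf := by
  obtain ⟨C, δ, cK, θ, hδ, hθ0, hθ1, hK, hKall⟩ := convCKWall_holds (Lc := Lc) hLc
  obtain ⟨C₃, c₃, θ₃, δ₃, hθ₃, hθ₃1, hδ₃, hE3, hE3d⟩ := e3ShapeDrift_three (Lc := Lc) hLc cE cVH cΛ
  exact forcing_locStencil₂_of_shapes (one_le_of_two_le hLc) hK hKall hδ hθ0 hθ1 hE3 hE3d hθ₃ hθ₃1 hδ₃ hmix hδ₄ hfm hm cE₂ cB hx hδ₂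

end Summit.QuantumFields.BalabanUV.Beta.GAN24.W3ForcingRate

end
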